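/-
Copyright (c) 2026 the pub-hodgecm-mathlib formalisation cell (harness21).  Prover seat hodgecm-mathlib-K2E4-p11 (g4), Track B ∕ K2-LIT, h413 =
`stmt-HodgeConjecture-24833`, line `K2_E1_TraceFormulaBeta`, campaign «EIS-RANK-ONE», (D5-b′) FILE A for the `K_∞`-type leaf of ★ (q8) p858560 (dealer K2E1-plan (g5)
2026-09-04T08:18:12Z «D-Q8 + defs leaf»; census 08:36Z): THE ARCHIMEDEAN COMPONENT OF `k ∈ K_U ≤ U(1,1)(𝔸_{L⁺})` AT A COMPLEX PLACE `w` IS `(a b; b a)` WITH `|a ± b| = 1`, and the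
last-row sums `r₀ + r₁`, `r₁ − r₀` transform under `g ↦ g·k` by the unit scalars `a + b`, `a − b`.
-/
import Literature.NumberTheory.Automorphic.UnitaryGroupBorelSiegelSet        -- ★ `mem_standardMaximalCompactGL_iff_toMixed_sndHom` (`k ∈ K ⟺ k_∞ ∈ K_∞ ∧ k_f ∈ GL_N(𝒪̂)`)
import Literature.NumberTheory.Automorphic.UnitaryGroupAdelicProduct          -- ★ `toMixed_mem_arch` (`g ∈ U(J)(𝔸) ⟹ g_∞ ∈ U(J)(E ⊗ ℝ)`)
import Literature.NumberTheory.Automorphic.UnitaryGroupArchimedeanPlaces      -- ★ `archAt`, `archLocal`, `mem_archLocal_iff_conjTranspose`, `evalC`, `complexConj_smul_infinitePlace`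
import Literature.NumberTheory.Automorphic.UnitaryGroupBorelHeight            -- ★ `lastRow`, `lastRow_mul`
import Literature.NumberTheory.Automorphic.UnitaryGroupGlobalGenericity       -- ★ `StdForm.antidiagonal_over_apply`, `antidiagonal_over_mul_apply`, `mul_antidiagonal_over_apply`
import Literature.NumberTheory.Automorphic.AdelicGLnGlue                      -- ★ `Kinf`, `mem_Kinf_iff`, `GLn.toMixed`, `mixedSpaceEvalComplex`
import HarnessLib

/-!
# h413 ∕ Track B «K2-LIT», «EIS-RANK-ONE» (D5-b′) FILE A — `K2E1ArchComponentKTypeU2`: for `k ∈ K_U ≤ U(1,1)(𝔸_{L⁺})` and a complex place `w` of the CM field `L`,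
# the `w`-component `k_w ∈ GL₂(ℂ)` is unitary and commutes with `J₂`, i.e. `k_w = (a b; b a)` with `|a + b| = |a − b| = 1`; the last-row sums scale by `a ± b`

Cell `pub/hodgecm-mathlib`, crux H413 = `stmt-HodgeConjecture-24833`, route `HCCMUnconditional`; dealer K2E1-plan (g5) (08:18:12Z «D-Q8 (+ defs leaf)»; my census 08:36:52Z: the leaf
splits into FILE A = this per-place matrix extraction, FILE B = the `def angularFactorTwo` + its line value).  THEOREMS ONLY (no `def`, no `instance`, no `notation`, no named-fact
hypothesis, no `sorry`); lane `--kind proof --supports stmt-HodgeConjecture-24833 --as helper` (count-neutral).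
WHY.  The `K_w`-types of `U(1,1)_w` (`K_w = U(2) ∩ U(1,1)_w ≅ U(1)²`, ABELIAN) are the characters `(a b; b a) ↦ (a+b)^p(a−b)^q`; the weight-`(p,q)` angular factor of `g` is read off the
last row `r = e₂·g` at `w` as `((r₀+r₁)∕|r₀+r₁|)^p((r₁−r₀)∕|r₁−r₀|)^q`, and THIS FILE proves the equivariance facts FILE B needs: under `g ↦ g·k` (`k ∈ K_U`) the sums `r₀+r₁`, `r₁−r₀` at `w`
are multiplied by the UNIT scalars `a+b`, `a−b`.  Without the `U(1,1)` relation a unitary `k_w` need not commute with `J₂`, and the angular factor along the big-cell line would not be an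
order-zero symbol uniformly in `k` (census 08:36Z) — the relation `k_wᴴ J₂ k_w = J₂` (★ `archAt`) together with `k_wᴴ k_w = 1` (★ `mem_Kinf_iff`) gives `J₂ k_w = k_w J₂`.
* §1 `archComponent_star_mul_self` (`k_wᴴk_w = 1`), `archComponent_conjTranspose_mul_J_mul` (`k_wᴴ J₂ k_w = J₂`), `archComponent_J_mul` (`J₂ k_w = k_w J₂`), `archComponent_apply_eq`
  (`k₀₀ = k₁₁`, `k₀₁ = k₁₀`), `norm_archComponent_add ∕ _sub` (`|k₀₀ ± k₀₁| = 1`).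
* §2 `evalC_lastRow_mul` (the `w`-coordinate of `lastRow (g·k) = lastRow g ᵥ* k`), **`evalC_lastRow_mul_add ∕ _sub`**: `(r·k)₀ + (r·k)₁ = (r₀+r₁)(a+b)`, `(r·k)₁ − (r·k)₀ = (r₁−r₀)(a−b)`, and
  the HEAD **`exists_unit_lastRow_sum_mul_of_mem`**: `∀ k ∈ K_U, ∀ w, ∃ u v, ‖u‖ = 1 ∧ ‖v‖ = 1 ∧ ∀ g, (sums of the `w`-coordinates of `lastRow (g·k)`) = (those of `g`)·u`, resp. `·v`.
HONEST LABEL.  Count-neutral helper; proves no printed statement; HC_CM is proved only modulo the 7 printed citations (2 remaining named inputs: hLiu418 =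
`stmt-HodgeConjecture-24832`, h413 = `stmt-HodgeConjecture-24833`) until rung 0 closes.

## References
* [BorelJacquet1979] A. Borel, H. Jacquet, *Automorphic forms and automorphic representations*, Corvallis (1979), §1.1, §4.1 (`K_∞`, `g = g_∞ g_f`).
* [Garrett2018] P. Garrett, *Modern Analysis of Automorphic Forms by Example* 1 (2018), §2.2 (Iwasawa coordinates, `K`-types of `U(1,1)`).
* [Knapp1986] A. W. Knapp, *Representation Theory of Semisimple Groups* (1986), Ch. I §1 (`U(n)`, `U(p,q)` and their maximal compact subgroups).
-/

set_option autoImplicit false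
set_option linter.dupNamespace false  -- the mandated namespace repeats the summit's segment (`HodgeConjecture.HodgeConjecture`)

noncomputable section

open NumberField NumberField.InfinitePlace NumberField.mixedEmbedding IsDedekindDomain
open Literature.NumberTheory.Automorphic Literature.NumberTheory.Automorphic.UnitaryGroup AdelicGroupData
open scoped ComplexConjugate Matrix

namespace Summit.HodgeConjecture.HodgeConjecture.Cruxes.H413.K2E1ArchComponentKTypeU2

variable (L : Type) [Field L] [NumberField L] [IsCMField L]

/-! ## §1 The `w`-component of `k ∈ K_U`: unitary, `U(1,1)`, hence `(a b; b a)` -/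

section Component

omit [NumberField L] [IsCMField L] in
/-- `σ_w J₂ = J₂` over `ℂ` (the entries of Mok's form are `0, 1`). [folklore] -/
theorem antidiagonal_over_map_embedding (w : {w : InfinitePlace L // w.IsComplex}) :
    ((StdForm.antidiagonal 2).over L).map w.1.embedding = ((StdForm.antidiagonal 2).over ℂ) :=
  StdForm.over_map _ _

/-- **`k_wᴴ k_w = 1`**: the `w`-component of `k ∈ K_U` is unitary (★ `mem_standardMaximalCompactGL_iff_toMixed_sndHom`, ★ `mem_Kinf_iff`). [cite: BorelJacquet1979, §1.1] -/
theorem archComponent_star_mul_self {k : (quasiSplit (↥(maximalRealSubfield L)) L (IsCMField.complexConj L) 2).Adelic} (hk : k ∈ ((standardMaximalCompactGL 2 L).comap (adelicVal ↥(maximalRealSubfield L) L (IsCMField.complexConj L) 2 ((StdForm.antidiagonal 2).over L)) : Subgroup (quasiSplit (↥(maximalRealSubfield L)) L (IsCMField.complexConj L) 2).Adelic)) (w : {w : InfinitePlace L // w.IsComplex}) :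
    star (((Matrix.GeneralLinearGroup.map (evalC L w) (GLn.toMixed 2 L (adelicVal ↥(maximalRealSubfield L) L (IsCMField.complexConj L) 2 ((StdForm.antidiagonal 2).over L) k)) : GL (Fin 2) ℂ)) : Matrix (Fin 2) (Fin 2) ℂ) * (((Matrix.GeneralLinearGroup.map (evalC L w) (GLn.toMixed 2 L (adelicVal ↥(maximalRealSubfield L) L (IsCMField.complexConj L) 2 ((StdForm.antidiagonal 2).over L) k)) : GL (Fin 2) ℂ)) : Matrix (Fin 2) (Fin 2) ℂ) = 1 := by
  have h := ((mem_Kinf_iff 2 L _).1 ((mem_standardMaximalCompactGL_iff_toMixed_sndHom _).1 hk).1).2 w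
  rw [mem_unitarySubgroupGL_iff] at h
  exact h

/-- **`k_wᴴ J₂ k_w = J₂`**: the `w`-component of ANY `k ∈ U(1,1)(𝔸_{L⁺})` lies in `U(J₂)(ℂ) = U(1,1)` (★ `toMixed_mem_arch`, ★ `archAt` at the place `w` fixed by `c`).
[cite: BorelJacquet1979, §4.1] -/
theorem archComponent_conjTranspose_mul_J_mul (k : (quasiSplit (↥(maximalRealSubfield L)) L (IsCMField.complexConj L) 2).Adelic) (w : {w : InfinitePlace L // w.IsComplex}) :
    (((Matrix.GeneralLinearGroup.map (evalC L w) (GLn.toMixed 2 L (adelicVal ↥(maximalRealSubfield L) L (IsCMField.complexConj L) 2 ((StdForm.antidiagonal 2).over L) k)) : GL (Fin 2) ℂ)) : Matrix (Fin 2) (Fin 2) ℂ)ᴴ * ((StdForm.antidiagonal 2).over ℂ) * (((Matrix.GeneralLinearGroup.map (evalC L w) (GLn.toMixed 2 L (adelicVal ↥(maximalRealSubfield L) L (IsCMField.complexConj L) 2 ((StdForm.antidiagonal 2).over L) k)) : GL (Fin 2) ℂ)) : Matrix (Fin 2) (Fin 2) ℂ) = ((StdForm.antidiagonal 2).over ℂ)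 := by
  have hmem := (archAt ↥(maximalRealSubfield L) L (IsCMField.complexConj L) 2 ((StdForm.antidiagonal 2).over L) w (complexConj_smul_infinitePlace L w.1)
    (IsCMField.complexConj_ne_one L) ⟨GLn.toMixed 2 L (adelicVal ↥(maximalRealSubfield L) L (IsCMField.complexConj L) 2 ((StdForm.antidiagonal 2).over L) k), toMixed_mem_arch ↥(maximalRealSubfield L) L (IsCMField.complexConj L) 2 ((StdForm.antidiagonal 2).over L) _ k.2⟩).2
  rw [mem_archLocal_iff_conjTranspose, antidiagonal_over_map_embedding] at hmem
  exact hmem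

/-- **`J₂ k_w = k_w J₂`** for `k ∈ K_U` (`k_wᴴ = k_w⁻¹` from unitarity, into `k_wᴴ J₂ k_w = J₂`). [cite: Knapp1986, Ch. I §1] -/
theorem archComponent_J_mul {k : (quasiSplit (↥(maximalRealSubfield L)) L (IsCMField.complexConj L) 2).Adelic} (hk : k ∈ ((standardMaximalCompactGL 2 L).comap (adelicVal ↥(maximalRealSubfield L) L (IsCMField.complexConj L) 2 ((StdForm.antidiagonal 2).over L)) : Subgroup (quasiSplit (↥(maximalRealSubfield L)) L (IsCMField.complexConj L) 2).Adelic)) (w : {w : InfinitePlace L // w.IsComplex}) :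
    ((StdForm.antidiagonal 2).over ℂ) * (((Matrix.GeneralLinearGroup.map (evalC L w) (GLn.toMixed 2 L (adelicVal ↥(maximalRealSubfield L) L (IsCMField.complexConj L) 2 ((StdForm.antidiagonal 2).over L) k)) : GL (Fin 2) ℂ)) : Matrix (Fin 2) (Fin 2) ℂ) = (((Matrix.GeneralLinearGroup.map (evalC L w) (GLn.toMixed 2 L (adelicVal ↥(maximalRealSubfield L) L (IsCMField.complexConj L) 2 ((StdForm.antidiagonal 2).over L) k)) : GL (Fin 2) ℂ)) : Matrix (Fin 2) (Fin 2) ℂ) * ((StdForm.antidiagonal 2).over ℂ) := by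
  have h1 := archComponent_star_mul_self L hk w
  rw [Matrix.star_eq_conjTranspose] at h1
  have h1' : (((Matrix.GeneralLinearGroup.map (evalC L w) (GLn.toMixed 2 L (adelicVal ↥(maximalRealSubfield L) L (IsCMField.complexConj L) 2 ((StdForm.antidiagonal 2).over L) k)) : GL (Fin 2) ℂ)) : Matrix (Fin 2) (Fin 2) ℂ) * (((Matrix.GeneralLinearGroup.map (evalC L w) (GLn.toMixed 2 L (adelicVal ↥(maximalRealSubfield L) L (IsCMField.complexConj L) 2 ((StdForm.antidiagonal 2).over L) k)) : GL (Fin 2) ℂ)) : Matrix (Fin 2) (Fin 2) ℂ)ᴴ = 1 := mul_eq_one_comm.1 h1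
  have h2 := archComponent_conjTranspose_mul_J_mul L k w
  calc ((StdForm.antidiagonal 2).over ℂ) * (((Matrix.GeneralLinearGroup.map (evalC L w) (GLn.toMixed 2 L (adelicVal ↥(maximalRealSubfield L) L (IsCMField.complexConj L) 2 ((StdForm.antidiagonal 2).over L) k)) : GL (Fin 2) ℂ)) : Matrix (Fin 2) (Fin 2) ℂ)
      = ((((Matrix.GeneralLinearGroup.map (evalC L w) (GLn.toMixed 2 L (adelicVal ↥(maximalRealSubfield L) L (IsCMField.complexConj L) 2 ((StdForm.antidiagonal 2).over L) k)) : GL (Fin 2) ℂ)) : Matrix (Fin 2) (Fin 2) ℂ) * (((Matrix.GeneralLinearGroup.map (evalC L w) (GLn.toMixed 2 L (adelicVal ↥(maximalRealSubfield L) L (IsCMField.complexConj L) 2 ((StdForm.antidiagonal 2).over L) k)) : GL (Fin 2) ℂ)) : Matrix (Fin 2) (Fin 2) ℂ)ᴴ) * ((StdForm.antidiagonal 2).over ℂ) * (((Matrix.GeneralLinearGroup.map (evalC L w) (GLn.toMixed 2 L (adelicVal ↥(maximalRealSubfield L) L (IsCMField.complexConj L) 2 ((StdForm.antidiagonal 2).over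 L) k)) : GL (Fin 2) ℂ)) : Matrix (Fin 2) (Fin 2) ℂ) := by rw [h1', Matrix.one_mul]
    _ = (((Matrix.GeneralLinearGroup.map (evalC L w) (GLn.toMixed 2 L (adelicVal ↥(maximalRealSubfield L) L (IsCMField.complexConj L) 2 ((StdForm.antidiagonal 2).over L) k)) : GL (Fin 2) ℂ)) : Matrix (Fin 2) (Fin 2) ℂ) * ((((Matrix.GeneralLinearGroup.map (evalC L w) (GLn.toMixed 2 L (adelicVal ↥(maximalRealSubfield L) L (IsCMField.complexConj L) 2 ((StdForm.antidiagonal 2).over L) k)) : GL (Fin 2) ℂ)) : Matrix (Fin 2) (Fin 2) ℂ)ᴴ * ((StdForm.antidiagonal 2).over ℂ) * (((Matrix.GeneralLinearGroup.map (evalC L w) (GLn.toMixed 2 L (adelicVal ↥(maximalRealSubfield L) L (IsCMField.complexConj L) 2 ((StdForm.antidiagonal 2).over L) k)) : GL (Fin 2) ℂ)) : Matrix (Fin 2) (Fin 2) ℂ)) := by simp only [Matrix.mul_assoc]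
    _ = (((Matrix.GeneralLinearGroup.map (evalC L w) (GLn.toMixed 2 L (adelicVal ↥(maximalRealSubfield L) L (IsCMField.complexConj L) 2 ((StdForm.antidiagonal 2).over L) k)) : GL (Fin 2) ℂ)) : Matrix (Fin 2) (Fin 2) ℂ) * ((StdForm.antidiagonal 2).over ℂ) := by rw [h2]

/-- **`k_w = (a b; b a)`**: `k₀₀ = k₁₁` and `k₀₁ = k₁₀` (`J₂ X` reverses rows, `X J₂` reverses columns; ★ `antidiagonal_over_mul_apply`, ★ `mul_antidiagonal_over_apply`).
[cite: Knapp1986, Ch. I §1] -/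
theorem archComponent_apply_eq {k : (quasiSplit (↥(maximalRealSubfield L)) L (IsCMField.complexConj L) 2).Adelic} (hk : k ∈ ((standardMaximalCompactGL 2 L).comap (adelicVal ↥(maximalRealSubfield L) L (IsCMField.complexConj L) 2 ((StdForm.antidiagonal 2).over L)) : Subgroup (quasiSplit (↥(maximalRealSubfield L)) L (IsCMField.complexConj L) 2).Adelic)) (w : {w : InfinitePlace L // w.IsComplex}) :
    (((Matrix.GeneralLinearGroup.map (evalC L w) (GLn.toMixed 2 L (adelicVal ↥(maximalRealSubfield L) L (IsCMField.complexConj L) 2 ((StdForm.antidiagonal 2).over L) k)) : GL (Fin 2) ℂ)) : Matrix (Fin 2) (Fin 2) ℂ) 0 0 = (((Matrix.GeneralLinearGroup.map (evalC L w) (GLn.toMixed 2 L (adelicVal ↥(maximalRealSubfield L) L (IsCMField.complexConj L) 2 ((StdForm.antidiagonal 2).over L) k)) : GL (Fin 2) ℂ)) : Matrix (Fin 2) (Fin 2) ℂ) 1 1 ∧ (((Matrix.GeneralLinearGroup.map (evalC L w) (GLn.toMixed 2 L (adelicVal ↥(maximalRealSubfield L) L (IsCMField.complexConj L) 2 ((StdForm.antidiagonal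 2).over L) k)) : GL (Fin 2) ℂ)) : Matrix (Fin 2) (Fin 2) ℂ) 0 1 = (((Matrix.GeneralLinearGroup.map (evalC L w) (GLn.toMixed 2 L (adelicVal ↥(maximalRealSubfield L) L (IsCMField.complexConj L) 2 ((StdForm.antidiagonal 2).over L) k)) : GL (Fin 2) ℂ)) : Matrix (Fin 2) (Fin 2) ℂ) 1 0 := by
  have h := archComponent_J_mul L hk w
  have h00 := congrFun (congrFun h 1) 0
  have h01 := congrFun (congrFun h 1) 1
  rw [antidiagonal_over_mul_apply, mul_antidiagonal_over_apply] at h00 h01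
  exact ⟨h00, h01⟩

/-- **`|k₀₀ + k₀₁| = 1` and `|k₀₀ − k₀₁| = 1`** (the first column of a unitary `(a b; b a)` is a unit vector with `Re(ā b) = 0`). [cite: Knapp1986, Ch. I §1] -/
theorem norm_archComponent_add_sub {k : (quasiSplit (↥(maximalRealSubfield L)) L (IsCMField.complexConj L) 2).Adelic} (hk : k ∈ ((standardMaximalCompactGL 2 L).comap (adelicVal ↥(maximalRealSubfield L) L (IsCMField.complexConj L) 2 ((StdForm.antidiagonal 2).over L)) : Subgroup (quasiSplit (↥(maximalRealSubfield L)) L (IsCMField.complexConj L) 2).Adelic)) (w : {w : InfinitePlace L // w.IsComplex}) :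
    ‖(((Matrix.GeneralLinearGroup.map (evalC L w) (GLn.toMixed 2 L (adelicVal ↥(maximalRealSubfield L) L (IsCMField.complexConj L) 2 ((StdForm.antidiagonal 2).over L) k)) : GL (Fin 2) ℂ)) : Matrix (Fin 2) (Fin 2) ℂ) 0 0 + (((Matrix.GeneralLinearGroup.map (evalC L w) (GLn.toMixed 2 L (adelicVal ↥(maximalRealSubfield L) L (IsCMField.complexConj L) 2 ((StdForm.antidiagonal 2).over L) k)) : GL (Fin 2) ℂ)) : Matrix (Fin 2) (Fin 2) ℂ) 0 1‖ = 1 ∧ ‖(((Matrix.GeneralLinearGroup.map (evalC L w) (GLn.toMixed 2 L (adelicVal ↥(maximalRealSubfield L) L (IsCMField.complexConj L) 2 ((StdForm.antidiagonal 2).over L) k)) : GL (Fin 2) ℂ)) : Matrix (Fin 2) (Fin 2) ℂ) 0 0 - (((Matrix.GeneralLinearGroup.map (evalC L w) (GLn.toMixed 2 L (adelicVal ↥(maximalRealSubfield L) L (IsCMField.complexConj L) 2 ((StdForm.antidiagonal 2).over L) k)) : GL (Fin 2) ℂ)) : Matrix (Fin 2) (Fin 2) ℂ) 0 1‖ = 1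 := by
  have h := archComponent_star_mul_self L hk w
  obtain ⟨h00, h01⟩ := archComponent_apply_eq L hk w
  rw [Matrix.star_eq_conjTranspose] at h
  -- `(kᴴk)₀₀ = |k₀₀|² + |k₁₀|² = 1`, `(kᴴk)₁₀ = conj k₀₁ k₀₀ + conj k₁₁ k₁₀ = 0`
  have e00 := congrFun (congrFun h 0) 0
  have e10 := congrFun (congrFun h 1) 0
  simp only [Matrix.mul_apply, Fin.sum_univ_two, Matrix.conjTranspose_apply, Matrix.one_apply_eq, Matrix.one_apply_ne (by decide : (1 : Fin 2) ≠ 0)] at e00 e10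
  rw [← h01, ← h00] at e10
  rw [← h01] at e00
  simp only [Complex.star_def] at e00 e10
  -- now `e00 : conj a * a + conj b * b = 1`, `e10 : conj b * a + conj a * b = 0` with `a = k₀₀`, `b = k₀₁`
  have hsum : Complex.normSq ((((Matrix.GeneralLinearGroup.map (evalC L w) (GLn.toMixed 2 L (adelicVal ↥(maximalRealSubfield L) L (IsCMField.complexConj L) 2 ((StdForm.antidiagonal 2).over L) k)) : GL (Fin 2) ℂ)) : Matrix (Fin 2) (Fin 2) ℂ) 0 0) + Complex.normSq ((((Matrix.GeneralLinearGroup.map (evalC L w) (GLn.toMixed 2 L (adelicVal ↥(maximalRealSubfield L) L (IsCMField.complexConj L) 2 ((StdForm.antidiagonal 2).over L) k)) : GL (Fin 2) ℂ)) : Matrix (Fin 2) (Fin 2) ℂ) 0 1) = 1 := by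
    rw [← Complex.normSq_eq_conj_mul_self, ← Complex.normSq_eq_conj_mul_self, ← Complex.ofReal_add, Complex.ofReal_eq_one] at e00
    exact e00
  have hre : ((((Matrix.GeneralLinearGroup.map (evalC L w) (GLn.toMixed 2 L (adelicVal ↥(maximalRealSubfield L) L (IsCMField.complexConj L) 2 ((StdForm.antidiagonal 2).over L) k)) : GL (Fin 2) ℂ)) : Matrix (Fin 2) (Fin 2) ℂ) 0 0 * conj ((((Matrix.GeneralLinearGroup.map (evalC L w) (GLn.toMixed 2 L (adelicVal ↥(maximalRealSubfield L) L (IsCMField.complexConj L) 2 ((StdForm.antidiagonal 2).over L) k)) : GL (Fin 2) ℂ)) : Matrix (Fin 2) (Fin 2) ℂ) 0 1)).re = 0 := by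
    have h3 := congrArg Complex.re e10
    rw [Complex.add_re, Complex.zero_re, mul_comm (conj ((((Matrix.GeneralLinearGroup.map (evalC L w) (GLn.toMixed 2 L (adelicVal ↥(maximalRealSubfield L) L (IsCMField.complexConj L) 2 ((StdForm.antidiagonal 2).over L) k)) : GL (Fin 2) ℂ)) : Matrix (Fin 2) (Fin 2) ℂ) 0 1)) ((((Matrix.GeneralLinearGroup.map (evalC L w) (GLn.toMixed 2 L (adelicVal ↥(maximalRealSubfield L) L (IsCMField.complexConj L) 2 ((StdForm.antidiagonal 2).over L) k)) : GL (Fin 2) ℂ)) : Matrix (Fin 2) (Fin 2) ℂ) 0 0),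
      show conj ((((Matrix.GeneralLinearGroup.map (evalC L w) (GLn.toMixed 2 L (adelicVal ↥(maximalRealSubfield L) L (IsCMField.complexConj L) 2 ((StdForm.antidiagonal 2).over L) k)) : GL (Fin 2) ℂ)) : Matrix (Fin 2) (Fin 2) ℂ) 0 0) * (((Matrix.GeneralLinearGroup.map (evalC L w) (GLn.toMixed 2 L (adelicVal ↥(maximalRealSubfield L) L (IsCMField.complexConj L) 2 ((StdForm.antidiagonal 2).over L) k)) : GL (Fin 2) ℂ)) : Matrix (Fin 2) (Fin 2) ℂ) 0 1 = conj ((((Matrix.GeneralLinearGroup.map (evalC L w) (GLn.toMixed 2 L (adelicVal ↥(maximalRealSubfield L) L (IsCMField.complexConj L) 2 ((StdForm.antidiagonal 2).over L) k)) : GL (Fin 2) ℂ)) : Matrix (Fin 2) (Fin 2) ℂ) 0 0 * conj ((((Matrix.GeneralLinearGroup.map (evalC L w) (GLn.toMixed 2 L (adelicVal ↥(maximalRealSubfield L) L (IsCMField.complexConj L) 2 ((StdForm.antidiagonal 2).over L) k)) : GL (Fin 2) ℂ)) : Matrix (Fin 2) (Fin 2) ℂ) 0 1)) by rw [map_mul,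 Complex.conj_conj], Complex.conj_re] at h3
    linarith
  refine ⟨?_, ?_⟩
  · rw [Complex.norm_def, Complex.normSq_add, hre, mul_zero, add_zero, hsum, Real.sqrt_one]
  · rw [Complex.norm_def, Complex.normSq_sub, hre, mul_zero, sub_zero, hsum, Real.sqrt_one]

end Component

/-! ## §2 The last row under `g ↦ g·k` at the coordinate `w` -/

section LastRow

omit [IsCMField L] in
/-- The `w`-coordinate of an adele is a ring homomorphism `𝔸_L → ℂ` (plumbing: `evalC w ∘ ι ∘ fst`). [folklore] -/
theorem evalC_ringEquiv_fst_mul (w : {w : InfinitePlace L // w.IsComplex}) (x y : AdeleRing (𝓞 L) L) :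
    evalC L w (InfiniteAdeleRing.ringEquiv_mixedSpace L (x * y).1) = evalC L w (InfiniteAdeleRing.ringEquiv_mixedSpace L (x).1) * evalC L w (InfiniteAdeleRing.ringEquiv_mixedSpace L (y).1) := by
  rw [show (x * y).1 = x.1 * y.1 from rfl, map_mul, map_mul]

omit [IsCMField L] in
/-- The `w`-coordinate of a finite sum of adeles. [folklore] -/
theorem evalC_ringEquiv_fst_sum (w : {w : InfinitePlace L // w.IsComplex}) (f : Fin 2 → AdeleRing (𝓞 L) L) :
    evalC L w (InfiniteAdeleRing.ringEquiv_mixedSpace L (∑ i, f i).1) = ∑ i, evalC L w (InfiniteAdeleRing.ringEquiv_mixedSpace L (f i).1) := by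
  rw [Fin.sum_univ_two, Fin.sum_univ_two, show (f 0 + f 1).1 = (f 0).1 + (f 1).1 from rfl, map_add, map_add]

/-- **The `w`-coordinates of `lastRow (g·k) = lastRow g ᵥ* k`** (★ `lastRow_mul`): `(r·k)_j = Σ_i r_i (k_w)_{ij}` with `(k_w)_{ij}` the `w`-coordinate of `k_{ij}` (★ `coe_toMixed_apply`, `rfl`).
[cite: Garrett2018, §2.2] -/
theorem evalC_lastRow_mul (g k : (quasiSplit (↥(maximalRealSubfield L)) L (IsCMField.complexConj L) 2).Adelic) (w : {w : InfinitePlace L // w.IsComplex}) (j : Fin 2) :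
    evalC L w (InfiniteAdeleRing.ringEquiv_mixedSpace L (lastRow (g * k) j).1) = ∑ i : Fin 2, evalC L w (InfiniteAdeleRing.ringEquiv_mixedSpace L (lastRow g i).1) * (((Matrix.GeneralLinearGroup.map (evalC L w) (GLn.toMixed 2 L (adelicVal ↥(maximalRealSubfield L) L (IsCMField.complexConj L) 2 ((StdForm.antidiagonal 2).over L) k)) : GL (Fin 2) ℂ)) : Matrix (Fin 2) (Fin 2) ℂ) i j := by
  rw [lastRow_mul, Matrix.vecMul, dotProduct, evalC_ringEquiv_fst_sum]
  refine Finset.sum_congr rfl fun i _ => ?_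
  rw [evalC_ringEquiv_fst_mul]
  rfl

/-- **THE LAST-ROW SUMS SCALE BY `a ± b`**: for `k ∈ K_U`, `(r·k)₀ + (r·k)₁ = (r₀ + r₁)·(k₀₀ + k₀₁)` and `(r·k)₁ − (r·k)₀ = (r₁ − r₀)·(k₀₀ − k₀₁)` at every complex place `w`
(`k_w = (a b; b a)`, §1). [cite: Garrett2018, §2.2] [cite: Knapp1986, Ch. I §1] -/
theorem evalC_lastRow_mul_add_sub {k : (quasiSplit (↥(maximalRealSubfield L)) L (IsCMField.complexConj L) 2).Adelic} (hk : k ∈ ((standardMaximalCompactGL 2 L).comap (adelicVal ↥(maximalRealSubfield L) L (IsCMField.complexConj L) 2 ((StdForm.antidiagonal 2).over L)) : Subgroup (quasiSplit (↥(maximalRealSubfield L)) L (IsCMField.complexConj L) 2).Adelic)) (w : {w : InfinitePlace L // w.IsComplex}) (g : (quasiSplit (↥(maximalRealSubfield L)) L (IsCMField.complexConj L) 2).Adelic) :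
    evalC L w (InfiniteAdeleRing.ringEquiv_mixedSpace L (lastRow (g * k) 0).1) + evalC L w (InfiniteAdeleRing.ringEquiv_mixedSpace L (lastRow (g * k) 1).1) = (evalC L w (InfiniteAdeleRing.ringEquiv_mixedSpace L (lastRow g 0).1) + evalC L w (InfiniteAdeleRing.ringEquiv_mixedSpace L (lastRow g 1).1)) * ((((Matrix.GeneralLinearGroup.map (evalC L w) (GLn.toMixed 2 L (adelicVal ↥(maximalRealSubfield L) L (IsCMField.complexConj L) 2 ((StdForm.antidiagonal 2).over L) k)) : GL (Fin 2) ℂ)) : Matrix (Fin 2) (Fin 2) ℂ) 0 0 + (((Matrix.GeneralLinearGroup.map (evalC L w) (GLn.toMixed 2 L (adelicVal ↥(maximalRealSubfield L) L (IsCMField.complexConj L) 2 ((StdForm.antidiagonal 2).over L) k)) : GL (Fin 2) ℂ)) : Matrix (Fin 2) (Fin 2) ℂ) 0 1) ∧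
    evalC L w (InfiniteAdeleRing.ringEquiv_mixedSpace L (lastRow (g * k) 1).1) - evalC L w (InfiniteAdeleRing.ringEquiv_mixedSpace L (lastRow (g * k) 0).1) = (evalC L w (InfiniteAdeleRing.ringEquiv_mixedSpace L (lastRow g 1).1) - evalC L w (InfiniteAdeleRing.ringEquiv_mixedSpace L (lastRow g 0).1)) * ((((Matrix.GeneralLinearGroup.map (evalC L w) (GLn.toMixed 2 L (adelicVal ↥(maximalRealSubfield L) L (IsCMField.complexConj L) 2 ((StdForm.antidiagonal 2).over L) k)) : GL (Fin 2) ℂ)) : Matrix (Fin 2) (Fin 2) ℂ) 0 0 - (((Matrix.GeneralLinearGroup.map (evalC L w) (GLn.toMixed 2 L (adelicVal ↥(maximalRealSubfield L) L (IsCMField.complexConj L) 2 ((StdForm.antidiagonal 2).over L) k)) : GL (Fin 2) ℂ)) : Matrix (Fin 2) (Fin 2) ℂ) 0 1) := by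
  obtain ⟨h00, h01⟩ := archComponent_apply_eq L hk w
  rw [evalC_lastRow_mul, evalC_lastRow_mul, Fin.sum_univ_two, Fin.sum_univ_two, ← h00, ← h01]
  constructor <;> ring

/-- **HEAD — THE `K_U`-EQUIVARIANCE DATA OF THE ANGULAR FACTORS.**  For every `k ∈ K_U` and every complex place `w` of `L` there are UNIT complex numbers `u = a + b`, `v = a − b`
(`k_w = (a b; b a)`) such that for EVERY `g ∈ U(1,1)(𝔸_{L⁺})` the `w`-coordinates of the last row satisfy `(r·k)₀ + (r·k)₁ = (r₀+r₁)·u`, `(r·k)₁ − (r·k)₀ = (r₁−r₀)·v` — so the weight-`(p,q)`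
angular factor `((r₀+r₁)∕|r₀+r₁|)^p((r₁−r₀)∕|r₁−r₀|)^q` transforms by the character `u^p v^q` of `K_w ≅ U(1)²` (FILE B plugs this into ★ (q8) §2 `lineSymbol_of_prod_angular`).
[cite: Garrett2018, §2.2] [cite: Knapp1986, Ch. I §1] [cite: BorelJacquet1979, §1.1] -/
theorem exists_unit_lastRow_sum_mul_of_mem {k : (quasiSplit (↥(maximalRealSubfield L)) L (IsCMField.complexConj L) 2).Adelic} (hk : k ∈ ((standardMaximalCompactGL 2 L).comap (adelicVal ↥(maximalRealSubfield L) L (IsCMField.complexConj L) 2 ((StdForm.antidiagonal 2).over L)) : Subgroup (quasiSplit (↥(maximalRealSubfield L)) L (IsCMField.complexConj L) 2).Adelic)) (w : {w : InfinitePlace L // w.IsComplex}) :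
    ∃ u v : ℂ, ‖u‖ = 1 ∧ ‖v‖ = 1 ∧ ∀ g : (quasiSplit (↥(maximalRealSubfield L)) L (IsCMField.complexConj L) 2).Adelic,
      evalC L w (InfiniteAdeleRing.ringEquiv_mixedSpace L (lastRow (g * k) 0).1) + evalC L w (InfiniteAdeleRing.ringEquiv_mixedSpace L (lastRow (g * k) 1).1) = (evalC L w (InfiniteAdeleRing.ringEquiv_mixedSpace L (lastRow g 0).1) + evalC L w (InfiniteAdeleRing.ringEquiv_mixedSpace L (lastRow g 1).1)) * u ∧
      evalC L w (InfiniteAdeleRing.ringEquiv_mixedSpace L (lastRow (g * k) 1).1) - evalC L w (InfiniteAdeleRing.ringEquiv_mixedSpace L (lastRow (g * k) 0).1) = (evalC L w (InfiniteAdeleRing.ringEquiv_mixedSpace L (lastRow g 1).1) - evalC L w (InfiniteAdeleRing.ringEquiv_mixedSpace L (lastRow g 0).1)) * v := by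
  obtain ⟨hu, hv⟩ := norm_archComponent_add_sub L hk w
  exact ⟨_, _, hu, hv, fun g => evalC_lastRow_mul_add_sub L hk w g⟩

end LastRow

end Summit.HodgeConjecture.HodgeConjecture.Cruxes.H413.K2E1ArchComponentKTypeU2

end
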